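import Mathlib.Algebra.Polynomial.Derivative
import Mathlib.Algebra.BigOperators.Fin
import Mathlib.FieldTheory.AlgebraicClosure
import Mathlib.Algebra.Algebra.Rat
import Mathlib.Data.Real.Basic

/-!
# `StokesGeneration` (stmt-KontsevichZagierPeriods-3586) — line `fibrewise_stokes`, stub `stub_loopZPow`

Registered stub W2 (rung 8) of the line `fibrewise_stokes` of the crux `StokesGeneration`
(route UnfoldedStokes): **integer powers of polynomial loops.** Given finitely many complex polynomial
loops `Pₖ = Aₖ + iBₖ` (real polynomials `Aₖ, Bₖ` with `ℚ`-algebraic coefficients, `Aₖ² + Bₖ² ≠ 0` on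
`[0,1]`) and integers `Nₖ`, there is ONE such loop `P' = A' + iB'` whose angular derivative
`Im(P'′/P') = (A' B'′ − A'′ B')/(A'² + B'²)` equals `Σₖ Nₖ · Im(Pₖ′/Pₖ)` on `[0,1]`; namely
`P' = Π_{Nₖ ≥ 0} Pₖ^{Nₖ} · Π_{Nₖ < 0} (conj Pₖ)^{−Nₖ}`.

Everything is done with REAL polynomial pairs `(A, B)` (no complex numbers):

* product loop `(A₁A₂ − B₁B₂, A₁B₂ + B₁A₂)`: `A² + B² = (A₁² + B₁²)(A₂² + B₂²)` and
  `A B′ − A′ B = (A₁B₁′ − A₁′B₁)(A₂² + B₂²) + (A₂B₂′ − A₂′B₂)(A₁² + B₁²)`, so the angular derivatives add;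
* conjugate loop `(A, −B)`: the angular derivative changes sign;
* natural powers by iterating the product, integer powers via the conjugate, and the stub by induction on
  the number of loops (`Fin.sum_univ_castSucc`).

Coefficients stay `ℚ`-algebraic because the `ℚ`-algebraic reals form a subfield (`algebraicClosure ℚ ℝ`).
[folklore]
-/

noncomputable section

-- `Summit.KontsevichZagierPeriods.KontsevichZagierPeriods.…` is the tree's mandated layout (single-conjunct summit).
set_option linter.dupNamespace false

namespace Summit.KontsevichZagierPeriods.KontsevichZagierPeriods.Cruxes.StokesGeneration.FibrewiseStokes

open Polynomial

/-! ## Algebraic coefficients are preserved by ring operations -/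

/-- The coefficients of a product of two real polynomials with `ℚ`-algebraic coefficients are
`ℚ`-algebraic (`(pq)ₙ = Σ_{i+j=n} pᵢ qⱼ` lies in the subfield `algebraicClosure ℚ ℝ`). [folklore] -/
private theorem loopZPow_algCoeff_mul {p q : Polynomial ℝ} (hp : ∀ n, IsAlgebraic ℚ (p.coeff n))
    (hq : ∀ n, IsAlgebraic ℚ (q.coeff n)) (n : ℕ) : IsAlgebraic ℚ ((p * q).coeff n) := by
  rw [Polynomial.coeff_mul, ← mem_algebraicClosure_iff]
  exact sum_mem fun x _ =>
    mul_mem (mem_algebraicClosure_iff.2 (hp x.1)) (mem_algebraicClosure_iff.2 (hq x.2))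

/-- The coefficients of a difference of two real polynomials with `ℚ`-algebraic coefficients are
`ℚ`-algebraic. [folklore] -/
private theorem loopZPow_algCoeff_sub {p q : Polynomial ℝ} (hp : ∀ n, IsAlgebraic ℚ (p.coeff n))
    (hq : ∀ n, IsAlgebraic ℚ (q.coeff n)) (n : ℕ) : IsAlgebraic ℚ ((p - q).coeff n) := by
  rw [Polynomial.coeff_sub]
  exact (hp n).sub (hq n)

/-- The coefficients of a sum of two real polynomials with `ℚ`-algebraic coefficients are
`ℚ`-algebraic. [folklore] -/
private theorem loopZPow_algCoeff_add {p q : Polynomial ℝ} (hp : ∀ n, IsAlgebraic ℚ (p.coeff n))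
    (hq : ∀ n, IsAlgebraic ℚ (q.coeff n)) (n : ℕ) : IsAlgebraic ℚ ((p + q).coeff n) := by
  rw [Polynomial.coeff_add]
  exact (hp n).add (hq n)

/-- The loop `1 = 1 + i·0` has `ℚ`-algebraic coefficients: those of the real polynomial `1`. [folklore] -/
private theorem loopZPow_algCoeff_one (n : ℕ) : IsAlgebraic ℚ ((1 : Polynomial ℝ).coeff n) := by
  rw [Polynomial.coeff_one]
  split_ifs
  · exact isAlgebraic_one
  · exact isAlgebraic_zero

/-- The loop `1 = 1 + i·0` has `ℚ`-algebraic coefficients: those of the real polynomial `0`. [folklore] -/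
private theorem loopZPow_algCoeff_zero (n : ℕ) : IsAlgebraic ℚ ((0 : Polynomial ℝ).coeff n) := by
  rw [Polynomial.coeff_zero]
  exact isAlgebraic_zero

/-! ## Product and conjugate of loops, pointwise -/

/-- Squared modulus of the product loop `(A₁ + iB₁)(A₂ + iB₂) = (A₁A₂ − B₁B₂) + i(A₁B₂ + B₁A₂)`:
`A² + B² = (A₁² + B₁²)(A₂² + B₂²)`. [folklore] -/
private theorem loopZPow_mul_normSq (A₁ B₁ A₂ B₂ : Polynomial ℝ) (u : ℝ) :
    (A₁ * A₂ - B₁ * B₂).eval u ^ 2 + (A₁ * B₂ + B₁ * A₂).eval u ^ 2 =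
      (A₁.eval u ^ 2 + B₁.eval u ^ 2) * (A₂.eval u ^ 2 + B₂.eval u ^ 2) := by
  simp only [Polynomial.eval_sub, Polynomial.eval_add, Polynomial.eval_mul]
  ring

/-- Angular derivative of the product loop: `Im((PQ)′/(PQ)) = Im(P′/P) + Im(Q′/Q)` wherever `P, Q ≠ 0`,
in real form `(A B′ − A′ B)/(A² + B²) = (A₁B₁′ − A₁′B₁)/(A₁² + B₁²) + (A₂B₂′ − A₂′B₂)/(A₂² + B₂²)` for
`A = A₁A₂ − B₁B₂`, `B = A₁B₂ + B₁A₂`. [folklore] -/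
private theorem loopZPow_mul_ang (A₁ B₁ A₂ B₂ : Polynomial ℝ) {u : ℝ}
    (h₁ : A₁.eval u ^ 2 + B₁.eval u ^ 2 ≠ 0) (h₂ : A₂.eval u ^ 2 + B₂.eval u ^ 2 ≠ 0) :
    ((A₁ * A₂ - B₁ * B₂).eval u * (derivative (A₁ * B₂ + B₁ * A₂)).eval u -
        (derivative (A₁ * A₂ - B₁ * B₂)).eval u * (A₁ * B₂ + B₁ * A₂).eval u) /
      ((A₁ * A₂ - B₁ * B₂).eval u ^ 2 + (A₁ * B₂ + B₁ * A₂).eval u ^ 2) =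
    (A₁.eval u * (derivative B₁).eval u - (derivative A₁).eval u * B₁.eval u) /
        (A₁.eval u ^ 2 + B₁.eval u ^ 2) +
      (A₂.eval u * (derivative B₂).eval u - (derivative A₂).eval u * B₂.eval u) /
        (A₂.eval u ^ 2 + B₂.eval u ^ 2) := by
  rw [loopZPow_mul_normSq, div_add_div _ _ h₁ h₂, div_left_inj' (mul_ne_zero h₁ h₂)]
  simp only [Polynomial.derivative_mul, Polynomial.derivative_sub, Polynomial.derivative_add,
    Polynomial.eval_sub, Polynomial.eval_add, Polynomial.eval_mul]
  ring

/-- Angular derivative of the conjugate loop `A − iB`: it is minus that of `A + iB`. [folklore] -/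
private theorem loopZPow_conj_ang (A B : Polynomial ℝ) (u : ℝ) :
    (A.eval u * (derivative (-B)).eval u - (derivative A).eval u * (-B).eval u) /
        (A.eval u ^ 2 + (-B).eval u ^ 2) =
      -((A.eval u * (derivative B).eval u - (derivative A).eval u * B.eval u) /
        (A.eval u ^ 2 + B.eval u ^ 2)) := by
  rw [Polynomial.derivative_neg, Polynomial.eval_neg, Polynomial.eval_neg, neg_sq, ← neg_div]
  ring

/-! ## Products, natural and integer powers of loops with algebraic coefficients -/

/-- Product of two zero-free loops with `ℚ`-algebraic coefficients: again such a loop, and its angular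
derivative on `[0,1]` is the sum of the two angular derivatives. [folklore] -/
private theorem loopZPow_exists_mul {A₁ B₁ A₂ B₂ : Polynomial ℝ} {f₁ f₂ : ℝ → ℝ}
    (hA₁ : ∀ n, IsAlgebraic ℚ (A₁.coeff n)) (hB₁ : ∀ n, IsAlgebraic ℚ (B₁.coeff n))
    (hA₂ : ∀ n, IsAlgebraic ℚ (A₂.coeff n)) (hB₂ : ∀ n, IsAlgebraic ℚ (B₂.coeff n))
    (h₁ : ∀ u ∈ Set.Icc (0:ℝ) 1, A₁.eval u ^ 2 + B₁.eval u ^ 2 ≠ 0)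
    (h₂ : ∀ u ∈ Set.Icc (0:ℝ) 1, A₂.eval u ^ 2 + B₂.eval u ^ 2 ≠ 0)
    (hf₁ : ∀ u ∈ Set.Icc (0:ℝ) 1,
      (A₁.eval u * (derivative B₁).eval u - (derivative A₁).eval u * B₁.eval u) /
        (A₁.eval u ^ 2 + B₁.eval u ^ 2) = f₁ u)
    (hf₂ : ∀ u ∈ Set.Icc (0:ℝ) 1,
      (A₂.eval u * (derivative B₂).eval u - (derivative A₂).eval u * B₂.eval u) /
        (A₂.eval u ^ 2 + B₂.eval u ^ 2) = f₂ u) :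
    ∃ A B : Polynomial ℝ, (∀ n, IsAlgebraic ℚ (A.coeff n)) ∧ (∀ n, IsAlgebraic ℚ (B.coeff n)) ∧
      (∀ u ∈ Set.Icc (0:ℝ) 1, A.eval u ^ 2 + B.eval u ^ 2 ≠ 0) ∧
      ∀ u ∈ Set.Icc (0:ℝ) 1,
        (A.eval u * (derivative B).eval u - (derivative A).eval u * B.eval u) /
          (A.eval u ^ 2 + B.eval u ^ 2) = f₁ u + f₂ u :=
  ⟨A₁ * A₂ - B₁ * B₂, A₁ * B₂ + B₁ * A₂,
    loopZPow_algCoeff_sub (loopZPow_algCoeff_mul hA₁ hA₂) (loopZPow_algCoeff_mul hB₁ hB₂),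
    loopZPow_algCoeff_add (loopZPow_algCoeff_mul hA₁ hB₂) (loopZPow_algCoeff_mul hB₁ hA₂),
    fun u hu => by rw [loopZPow_mul_normSq]; exact mul_ne_zero (h₁ u hu) (h₂ u hu),
    fun u hu => by rw [loopZPow_mul_ang _ _ _ _ (h₁ u hu) (h₂ u hu), hf₁ u hu, hf₂ u hu]⟩

/-- Natural powers `Pⁿ` of a zero-free loop `P = A + iB` with `ℚ`-algebraic coefficients: again such a
loop, with angular derivative `n · Im(P′/P)` on `[0,1]` (iterate the product, starting from the constant
loop `1`). [folklore] -/
private theorem loopZPow_exists_pow {A B : Polynomial ℝ}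
    (hA : ∀ n, IsAlgebraic ℚ (A.coeff n)) (hB : ∀ n, IsAlgebraic ℚ (B.coeff n))
    (h0 : ∀ u ∈ Set.Icc (0:ℝ) 1, A.eval u ^ 2 + B.eval u ^ 2 ≠ 0) (n : ℕ) :
    ∃ A' B' : Polynomial ℝ, (∀ m, IsAlgebraic ℚ (A'.coeff m)) ∧ (∀ m, IsAlgebraic ℚ (B'.coeff m)) ∧
      (∀ u ∈ Set.Icc (0:ℝ) 1, A'.eval u ^ 2 + B'.eval u ^ 2 ≠ 0) ∧
      ∀ u ∈ Set.Icc (0:ℝ) 1,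
        (A'.eval u * (derivative B').eval u - (derivative A').eval u * B'.eval u) /
            (A'.eval u ^ 2 + B'.eval u ^ 2) =
          (n : ℝ) * ((A.eval u * (derivative B).eval u - (derivative A).eval u * B.eval u) /
            (A.eval u ^ 2 + B.eval u ^ 2)) := by
  induction n with
  | zero =>
    exact ⟨1, 0, loopZPow_algCoeff_one, loopZPow_algCoeff_zero, fun u _ => by simp, fun u _ => by simp⟩
  | succ n ih =>
    obtain ⟨A', B', hA', hB', h0', hf'⟩ := ih
    obtain ⟨A'', B'', hA'', hB'', h0'', hf''⟩ :=
      loopZPow_exists_mul hA' hB' hA hB h0' h0 hf' (f₂ := fun u =>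
        (A.eval u * (derivative B).eval u - (derivative A).eval u * B.eval u) /
          (A.eval u ^ 2 + B.eval u ^ 2)) (fun u _ => rfl)
    refine ⟨A'', B'', hA'', hB'', h0'', fun u hu => ?_⟩
    rw [hf'' u hu, Nat.cast_succ]
    ring

/-- Integer powers of a zero-free loop `P = A + iB` with `ℚ`-algebraic coefficients: for `N ≥ 0` the
loop `P^N`, for `N < 0` the conjugate loop `(conj P)^{−N}`; in both cases a zero-free loop with
`ℚ`-algebraic coefficients and angular derivative `N · Im(P′/P)` on `[0,1]`. [folklore] -/
private theorem loopZPow_exists_zpow {A B : Polynomial ℝ}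
    (hA : ∀ n, IsAlgebraic ℚ (A.coeff n)) (hB : ∀ n, IsAlgebraic ℚ (B.coeff n))
    (h0 : ∀ u ∈ Set.Icc (0:ℝ) 1, A.eval u ^ 2 + B.eval u ^ 2 ≠ 0) (N : ℤ) :
    ∃ A' B' : Polynomial ℝ, (∀ m, IsAlgebraic ℚ (A'.coeff m)) ∧ (∀ m, IsAlgebraic ℚ (B'.coeff m)) ∧
      (∀ u ∈ Set.Icc (0:ℝ) 1, A'.eval u ^ 2 + B'.eval u ^ 2 ≠ 0) ∧
      ∀ u ∈ Set.Icc (0:ℝ) 1,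
        (A'.eval u * (derivative B').eval u - (derivative A').eval u * B'.eval u) /
            (A'.eval u ^ 2 + B'.eval u ^ 2) =
          (N : ℝ) * ((A.eval u * (derivative B).eval u - (derivative A).eval u * B.eval u) /
            (A.eval u ^ 2 + B.eval u ^ 2)) := by
  obtain ⟨n, rfl | rfl⟩ := Int.eq_nat_or_neg N
  · obtain ⟨A', B', hA', hB', h0', hf'⟩ := loopZPow_exists_pow hA hB h0 n
    exact ⟨A', B', hA', hB', h0', fun u hu => by rw [hf' u hu, Int.cast_natCast]⟩
  · obtain ⟨A', B', hA', hB', h0', hf'⟩ := loopZPow_exists_pow hA hB h0 n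
    refine ⟨A', -B', hA', fun m => ?_, fun u hu => ?_, fun u hu => ?_⟩
    · rw [Polynomial.coeff_neg]
      exact (hB' m).neg
    · rw [Polynomial.eval_neg, neg_sq]
      exact h0' u hu
    · rw [loopZPow_conj_ang, hf' u hu, Int.cast_neg, Int.cast_natCast]
      ring

/-! ## The stub -/

/-- STUB (rung 8, W2) **integer powers of polynomial loops.** Given zero-free complex polynomial loops
`Pₖ = Aₖ + iBₖ` on `[0,1]` (real polynomials with `ℚ`-algebraic coefficients, `Aₖ² + Bₖ² ≠ 0` on `[0,1]`)
and integers `Nₖ`, there is one zero-free loop `P' = A' + iB'` with `ℚ`-algebraic coefficients whose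
angular derivative `(A' B'′ − A'′ B')/(A'² + B'²) = Im(P'′/P')` equals `Σₖ Nₖ · Im(Pₖ′/Pₖ)` on `[0,1]`
(`P' = Πₖ Pₖ^{[Nₖ]}` with `P^{[N]} = P^N` for `N ≥ 0` and `(conj P)^{−N}` for `N < 0`; induction on the
number of loops). [folklore] -/
theorem stub_loopZPow :
    ∀ (s : ℕ) (A B : Fin s → Polynomial ℝ) (N : Fin s → ℤ),
      (∀ k n, IsAlgebraic ℚ ((A k).coeff n)) → (∀ k n, IsAlgebraic ℚ ((B k).coeff n)) →
      (∀ k, ∀ u ∈ Set.Icc (0:ℝ) 1, (A k).eval u ^ 2 + (B k).eval u ^ 2 ≠ 0) →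
      ∃ (A' B' : Polynomial ℝ), (∀ n, IsAlgebraic ℚ (A'.coeff n)) ∧ (∀ n, IsAlgebraic ℚ (B'.coeff n)) ∧
        (∀ u ∈ Set.Icc (0:ℝ) 1, A'.eval u ^ 2 + B'.eval u ^ 2 ≠ 0) ∧
        ∀ u ∈ Set.Icc (0:ℝ) 1,
          (A'.eval u * (Polynomial.derivative B').eval u - (Polynomial.derivative A').eval u * B'.eval u) /
              (A'.eval u ^ 2 + B'.eval u ^ 2) =
            ∑ k, (N k : ℝ) * (((A k).eval u * (Polynomial.derivative (B k)).eval u -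
              (Polynomial.derivative (A k)).eval u * (B k).eval u) / ((A k).eval u ^ 2 + (B k).eval u ^ 2)) := by
  intro s
  induction s with
  | zero =>
    intro A B N _ _ _
    exact ⟨1, 0, loopZPow_algCoeff_one, loopZPow_algCoeff_zero, fun u _ => by simp, fun u _ => by simp⟩
  | succ s ih =>
    intro A B N hA hB h0
    obtain ⟨A₁, B₁, hA₁, hB₁, h0₁, hf₁⟩ := ih (fun k => A (Fin.castSucc k)) (fun k => B (Fin.castSucc k))
      (fun k => N (Fin.castSucc k)) (fun k n => hA _ n) (fun k n => hB _ n) (fun k => h0 _)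
    obtain ⟨A₂, B₂, hA₂, hB₂, h0₂, hf₂⟩ :=
      loopZPow_exists_zpow (hA (Fin.last s)) (hB (Fin.last s)) (h0 (Fin.last s)) (N (Fin.last s))
    obtain ⟨A', B', hA', hB', h0', hf'⟩ := loopZPow_exists_mul hA₁ hB₁ hA₂ hB₂ h0₁ h0₂ hf₁ hf₂
    refine ⟨A', B', hA', hB', h0', fun u hu => ?_⟩
    rw [hf' u hu, Fin.sum_univ_castSucc]

end Summit.KontsevichZagierPeriods.KontsevichZagierPeriods.Cruxes.StokesGeneration.FibrewiseStokes

end
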